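import Literature.AlgebraicGeometry.HodgeTheory.PolarizedLimitMixedHodgeStructureSharpInvariantClasses
import Literature.AlgebraicGeometry.HodgeTheory.PolarizedLimitMixedHodgeStructureNilpotentOrbitRate
import Literature.AlgebraicGeometry.HodgeTheory.PolarizedLimitMixedHodgeStructureHodgeClassLimit
import Mathlib.Analysis.Normed.Module.FiniteDimension
import HarnessLib

/-!
# The rescaled limit of a sequence of Hodge classes near the puncture is an `𝔰𝔩₂`-invariant limit Hodge class
# (Cattani–Deligne–Kaplan, Prop. 4.7 / Lemma 4.5, one variable, nilpotent orbit): the constant top class is killed by `N`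

Topic `Literature/AlgebraicGeometry/HodgeTheory` (namespaces `…HodgeTheory.LimitMixedHodgeStructure`, `…PolarizedLimitMixedHodgeStructure`).
Theorems only; no definition, no instance, no named fact (D-0026 net debt `0`).

PRINTED SOURCE, VERBATIM. E. Cattani, P. Deligne, A. Kaplan, *On the locus of Hodge classes*, J. Amer. Math. Soc. 8 (1995) 483–506,
proof of **Proposition 4.7** (pp. 503–504): «If we transform the assumption `u(n) ∼_z Φ⁰` by `e(τ(n))` (notations of (3.6.1)), we obtain
`e(τ(n))u(n) ∼_z e(τ(n))Φ⁰(z(n))` … The Hodge norm of `e(τ(n))u(n)` in this metric — equal to that of `u(n)` in the Hodge metric for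
`Φ(z(n))` — is bounded by assumption. The `e(τ(n))Φ(z(n))` tend to the Hodge filtration `F_♯` (cf. 3.6). The Hodge metric for
`e(τ(n))Φ(z(n))` tends to that for `F_♯`. It follows that `e(τ(n))u(n)` remains bounded and, taking a subsequence, we may and shall
assume that it has a limit `u₀`. We have `u₀ ∈ F_♯⁰`, real. … By 3.10, `u₀` is in the sum of the `V^l` with `l₁ = 0` and is in the kernel
of `T₁`. The components `u(n)^{(l)}` of `u(n)`, for `l₁ = 0`, depend only on `u¹`: they are independent of `n`. … The `0`-component
`u(n)^{(0)}` coincides with `u₀`, killed by `T₁`.»  (One variable: `d = 1`, `T₁ = N`, `e(τ) = ρ̃(√y)⁻¹`, `F_♯ = F̂_♯`.)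

THE TREE'S SETTING (one variable, the nilpotent orbit `θ(z) = exp(zN)·F` of `L : PolarizedLimitMixedHodgeStructure V k`, `Im z > β`).
The rescaling is by the element `ĝ_z = exp((Re z)N) ρ̃(√Im z) ∈ G_ℝ` of the `δ`-splitting (`orbitAut`), for which
`θ(z) = ĝ_z·(u_{√Im z}·F̂_♯)` with `|u_t − 1|₀ = O(t⁻²)` (`map_exp_smul_N_F_eq_map_orbitAut`, `exists_hodgeNorm_orbitPerturbation_sub_le`)
and `‖ĝ_z w‖_{θ̂(z)} = |w|₀`; CDK's `e(τ(n))u(n)` is `w_n := ĝ_{z_n}⁻¹ x_n` (§1: `|w_n|₀ ≤ 2‖x_n‖_{θ(z_n)}`, `w_n ∈ u_{√y_n}·F̂_♯^p`,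
`w_n` real, `w_n ∈ W_k`, `π̂_k w_n = π̂_k x_n`).

MAIN THEOREM (§3, `N_deligneEProj_eq_zero_of_seq` and `sl2_invariant_deligneEProj_of_seq`): let `x_n ∈ W_{k,ℂ}` be REAL classes of
type `(p, k−p)` at points `θ(z_n)` with `Im z_n → ∞` (any `Re z_n`), of Hodge norm `‖x_n‖_{θ(z_n)} ≤ C`, whose top components
`π̂_k x_n = û` are CONSTANT.  Then **`N û = 0`, `N̂⁺ û = 0`, `û ∈ Î^{p,k−p}`**: the common top class is an `𝔰𝔩₂`-invariant limit
Hodge class.  Proof = CDK's: `w_n` is `|·|₀`-bounded, so a subsequence converges (Bolzano–Weierstrass in the finite-dimensional normed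
space `(V_ℂ, |·|₀)`, the tree's `hodgeNormedAddCommGroup` of `F̂_♯`) to `u₀`; `u₀ ∈ W_k` (closed), `u₀` real (`|x̄|₀ = |x|₀`),
`u₀ ∈ F̂_♯^p` (`w_n = u_{t_n} f_n`, `f_n ∈ F̂_♯^p`, `|f_n − w_n|₀ ≤ 4CK/t_n²`), and `π̂_k u₀ = û` (`π̂_k` bounded); by Prop. 3.10
(`PolarizedLimitMixedHodgeStructureSharpInvariantClasses`) `u₀ ∈ Ê_k ∩ ker N ∩ ker N̂⁺ ∩ Î^{p,p}`, so `u₀ = π̂_k u₀ = û`.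

NOT HERE: the integrality that makes `π̂_k x_n` constant along a subsequence (CDK 4.6; `…IntegralClassesWeightBound`) and the
assembly of Thm. 2.5 — the next file; several variables (CDK's induction on `d`).

## References

* [CattaniDeligneKaplan1995] E. Cattani, P. Deligne, A. Kaplan, *On the locus of Hodge classes*, J. Amer. Math. Soc. 8 (1995)
  483–506: Prop. 3.10 (p. 499), Lemma 4.5 (p. 502), Prop. 4.7 and proof (pp. 503–504), (3.6.1)–(3.6.2) (p. 497).
* [CattaniKaplanSchmid1987] E. Cattani, A. Kaplan, W. Schmid, LNM 1246 (1987): §3 Thm. (3.3) (i)–(ii), Cor. (3.7) (pp. 19–22).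
* [CattaniKaplanSchmid1986] E. Cattani, A. Kaplan, W. Schmid, Ann. of Math. 123 (1986): §3 (cite only).
* [Schmid1973] W. Schmid, Invent. Math. 22 (1973): Thm. (6.6) (cite only).
-/

noncomputable section

open scoped TensorProduct ComplexOrder
open Filter Topology

namespace Literature.AlgebraicGeometry

open Module
open Motives Motives.MixedHodgeStructure
open Motives.HodgeStructure (conj conj_conj complexConj mem_complexConj conj_apply_eq_endConj endConj)

universe u

variable {V : Type u} [AddCommGroup V] [Module ℚ V] [FiniteDimensional ℚ V] {k : ℤ}

/-! ## §0 Pure Hodge structures: a real vector of type `(p, q)`, `p ≠ q`, vanishes -/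

namespace Motives.HodgeStructure

omit [FiniteDimensional ℚ V] in
/-- A REAL vector (`x̄ = x`) of pure type `(p, q)` with `p ≠ q` is zero (`x ∈ H^{p,q} ∩ H^{q,p}`): real Hodge classes live in the
middle. [cite: CattaniDeligneKaplan1995, 2.9 and Remark 2.6 (pp. 488–490)] -/
theorem eq_zero_of_conj_eq_of_mem_piece_of_ne {n : ℤ} (H : HodgeStructure V n) {p q : ℤ} (hpq : p ≠ q) {x : ℂ ⊗[ℚ] V}
    (hreal : conj x = x) (hx : x ∈ H.piece p q) : x = 0 := by
  by_cases hn : p + q = n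
  · obtain ⟨hp, hq⟩ := (H.mem_piece_iff hn).1 hx
    rw [hreal] at hq
    rcases lt_or_gt_of_ne hpq with h | h
    · exact H.eq_zero_of_mem_F_of_conj_mem_F_of_lt (show n < q + q by omega) hq (hreal.symm ▸ hq)
    · exact H.eq_zero_of_mem_F_of_conj_mem_F_of_lt (show n < p + p by omega) hp (hreal.symm ▸ hp)
  · rw [H.piece_eq_bot_of_add_ne hn, Submodule.mem_bot] at hx
    exact hx

end Motives.HodgeStructure

namespace HodgeTheory

/-! ## §1 The torus `ρ̃(t)` and the grading: `π_m ρ̃(c) = c^{k−m} π_m`, `ρ̃(c) W_m ⊆ W_m` -/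

namespace LimitMixedHodgeStructure

variable (L : LimitMixedHodgeStructure V k)

/-- The total weights `p + q` of the nonzero `I^{p,q}` lie in a finite set. [folklore] -/
private theorem exists_weights_subset :
    ∃ s : Finset ℤ, ∀ p q : ℤ, L.toMixedHodgeStructure.deligneI p q ≠ ⊥ → p + q ∈ s := by
  classical
  refine ⟨L.toMixedHodgeStructure.finite_setOf_deligneFamily_ne_bot.toFinset.image fun pq => pq.1 + pq.2,
    fun p q h => Finset.mem_image.2 ⟨(p, q), ?_, rfl⟩⟩
  rw [Set.Finite.mem_toFinset, Set.mem_setOf_eq, deligneFamily_apply]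
  exact h

/-- `π_m x = 0` for a weight `m` outside any finite set carrying the nonzero `I^{p,q}`. [folklore] -/
private theorem deligneEProj_apply_eq_zero_of_not_mem {s : Finset ℤ}
    (hs : ∀ p q : ℤ, L.toMixedHodgeStructure.deligneI p q ≠ ⊥ → p + q ∈ s) {m : ℤ} (hm : m ∉ s) (x : ℂ ⊗[ℚ] V) :
    L.toMixedHodgeStructure.deligneEProj m x = 0 := by
  conv_lhs => rw [← L.toMixedHodgeStructure.sum_deligneEProj_apply s hs x]
  rw [map_sum]
  refine Finset.sum_eq_zero fun m' hm' => ?_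
  rw [L.toMixedHodgeStructure.deligneEProj_deligneEProj_apply]
  exact if_neg fun h : m' = m => hm (h ▸ hm')

/-- **`π_m (ρ̃(c) x) = c^{k−m} π_m x`**: the torus `ρ̃(c)` acts by the scalar `c^{k−m}` on `E_m`, so it commutes with the projections
up to that scalar. [cite: CattaniDeligneKaplan1995, (3.6.1) (p. 497) ("e(r) acts by multiplication by Π r_j^{l_j/2} on V^l")]
[cite: CattaniKaplanSchmid1987, §3 (3.3) (ii)] -/
theorem deligneEProj_splitTorus_apply (c : ℂ) (m : ℤ) (x : ℂ ⊗[ℚ] V) :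
    L.toMixedHodgeStructure.deligneEProj m (L.splitTorus c x) = c ^ (k - m) • L.toMixedHodgeStructure.deligneEProj m x := by
  classical
  obtain ⟨s, hs⟩ := L.exists_weights_subset
  conv_lhs => rw [← L.toMixedHodgeStructure.sum_deligneEProj_apply s hs x]
  rw [map_sum, map_sum]
  have hterm : ∀ m' ∈ s, L.toMixedHodgeStructure.deligneEProj m (L.splitTorus c (L.toMixedHodgeStructure.deligneEProj m' x)) =
      if m' = m then c ^ (k - m) • L.toMixedHodgeStructure.deligneEProj m x else 0 := by
    intro m' _
    rw [L.splitTorus_apply_of_mem_deligneE c (L.toMixedHodgeStructure.deligneEProj_apply_mem m' x), map_smul,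
      L.toMixedHodgeStructure.deligneEProj_deligneEProj_apply]
    split_ifs with h
    · rw [h]
    · rw [smul_zero]
  rw [Finset.sum_congr rfl hterm, Finset.sum_ite_eq' s m]
  split_ifs with hm
  · rfl
  · rw [L.deligneEProj_apply_eq_zero_of_not_mem hs hm x, smul_zero]

/-- **`ρ̃(c) W_{m,ℂ} ⊆ W_{m,ℂ}`** (`W_m ⊗ ℂ = ⊕_{m' ≤ m} E_{m'}` and `ρ̃(c)` is a scalar on each `E_{m'}`).
[cite: CattaniDeligneKaplan1995, (3.6.1) (p. 497)] [cite: CattaniKaplanSchmid1987, §3 (3.3) (ii)] -/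
theorem splitTorus_apply_mem_baseChange_W (c : ℂ) {m : ℤ} {x : ℂ ⊗[ℚ] V} (hx : x ∈ (L.W m).baseChange ℂ) :
    L.splitTorus c x ∈ (L.W m).baseChange ℂ := by
  classical
  obtain ⟨s, hs⟩ := L.exists_weights_subset
  refine L.toMixedHodgeStructure.mem_baseChange_W_of_forall_deligneEProj_eq_zero s hs fun m' _ hlt => ?_
  rw [L.deligneEProj_splitTorus_apply, L.toMixedHodgeStructure.deligneEProj_apply_eq_zero_of_mem_baseChange_W hlt hx, smul_zero]

/-- `ρ̃(√Im z) w = exp(−(Re z)N) (ĝ_z w)` — unfolding `ĝ_z = exp((Re z)N) ρ̃(√Im z)`. [cite: CattaniKaplanSchmid1987, §3 Thm. (3.3) (i)] -/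
theorem splitTorus_apply_eq_exp_neg_smul_N_orbitAut (z : ℂ) (w : ℂ ⊗[ℚ] V) :
    L.splitTorus (Real.sqrt z.im) w = IsNilpotent.exp (-((z.re : ℂ) • L.N.baseChange ℂ)) (L.orbitAut z w) := by
  rw [orbitAut, Module.End.mul_apply, ← Module.End.mul_apply (IsNilpotent.exp (-((z.re : ℂ) • L.N.baseChange ℂ))),
    IsNilpotent.exp_neg_mul_exp_self (L.isNilpotent_N_baseChange.smul _), Module.End.one_apply]

/-- `w = ρ̃((√Im z)⁻¹) (exp(−(Re z)N) (ĝ_z w))` for `Im z > 0` — the inverse of `ĝ_z`. [cite: CattaniKaplanSchmid1987, §3 Thm. (3.3) (i)] -/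
theorem eq_splitTorus_inv_exp_neg_apply_orbitAut {z : ℂ} (hz : 0 < z.im) (w : ℂ ⊗[ℚ] V) :
    w = L.splitTorus ((Real.sqrt z.im : ℂ)⁻¹) (IsNilpotent.exp (-((z.re : ℂ) • L.N.baseChange ℂ)) (L.orbitAut z w)) := by
  have ht : ((Real.sqrt z.im : ℝ) : ℂ) ≠ 0 := by exact_mod_cast (Real.sqrt_pos.2 hz).ne'
  rw [← L.splitTorus_apply_eq_exp_neg_smul_N_orbitAut, ← Module.End.mul_apply, L.splitTorus_inv_mul_splitTorus ht,
    Module.End.one_apply]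

end LimitMixedHodgeStructure

/-! ## §2 The rescaled vector `w = ĝ_z⁻¹ x` of the `δ`-splitting: norm, filtration, reality, weight, top component -/

namespace PolarizedLimitMixedHodgeStructure

variable (L : PolarizedLimitMixedHodgeStructure V k)

/-- **`|w|₀ = ‖ĝ_z w‖_{θ̂(z)}`**: `ĝ_z ∈ G_ℝ` carries the reference norm (the Hodge norm of `F̂_♯`) to the Hodge norm of the split orbit
`θ̂(z) = ĝ_z·F̂_♯` — «the Hodge norm of `e(τ(n))u(n)` in this metric — equal to that of `u(n)` in the Hodge metric for `Φ(z(n))`».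
[cite: CattaniDeligneKaplan1995, proof of Prop. 4.7 (p. 504) and Prop. 3.8 (ii)] [cite: CattaniKaplanSchmid1987, §3 Cor. (3.7)] -/
theorem hodgeNorm_splitNilpotentOrbit_orbitAut {z : ℂ} (hz : 0 < z.im) (w : ℂ ⊗[ℚ] V) :
    (L.deltaSplit.splitNilpotentOrbitPolarization L.isSplitOverR_deltaSplit z hz).hodgeNorm
        (L.deltaSplit.toLimitMixedHodgeStructure.orbitAut z w) = L.referenceNorm w :=
  (L.deltaSplit.sharpPolarization L.isSplitOverR_deltaSplit).hodgeNorm_translate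
    (L.deltaSplit.toLimitMixedHodgeStructure.endConj_orbitAut L.isSplitOverR_deltaSplit z)
    (L.deltaSplit.toLimitMixedHodgeStructure.orbitAut_injective hz)
    (L.deltaSplit.toLimitMixedHodgeStructure.orbitAut_surjective hz) (L.deltaSplit.Q_baseChange_orbitAut hz) w

/-- **`|w|₀ ≤ 2 ‖x‖_{θ(z)}` for `ĝ_z w = x`, `Im z > β`** (`‖x‖_{θ̂(z)} ≤ 2‖x‖_{θ(z)}`, the tree's quasi-isometry): «it follows that
`e(τ(n))u(n)` remains bounded». [cite: CattaniDeligneKaplan1995, proof of Prop. 4.7 (p. 504)] [cite: CattaniKaplanSchmid1987, §3 Cor. (3.7)] -/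
theorem referenceNorm_le_two_mul_hodgeNorm_of_orbitAut_eq {z : ℂ} (hz : L.normThreshold < z.im) {w x : ℂ ⊗[ℚ] V}
    (hw : L.deltaSplit.toLimitMixedHodgeStructure.orbitAut z w = x) :
    L.referenceNorm w ≤ 2 * (L.nilpotentOrbitPolarization z (L.orbitThreshold_lt_im hz)).hodgeNorm x := by
  have h := (L.hodgeNorm_nilpotentOrbit_mem_Icc hz x).1
  rw [← hw, L.hodgeNorm_splitNilpotentOrbit_orbitAut (L.im_pos_of_normThreshold_lt hz)] at h
  rw [← hw]
  linarith

/-- **`w ∈ u_{√Im z}·F̂_♯^p` when `ĝ_z w = x ∈ θ(z)^p`** (`θ(z)^p = ĝ_z·(u_{√Im z}·F̂_♯^p)` and `ĝ_z` is injective): «we obtain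
`e(τ(n))u(n) ∼ e(τ(n))Φ⁰(z(n))`», exactly. [cite: CattaniDeligneKaplan1995, proof of Prop. 4.7 (p. 504)] [cite: CattaniKaplanSchmid1987, §3 Thm. (3.3) (i)] -/
theorem mem_map_orbitPerturbation_sharp_F_of_orbitAut_eq {z : ℂ} (hz : L.orbitThreshold < z.im) (hz0 : 0 < z.im) {p : ℤ}
    {w x : ℂ ⊗[ℚ] V} (hw : L.deltaSplit.toLimitMixedHodgeStructure.orbitAut z w = x) (hx : x ∈ (L.nilpotentOrbit z hz).F p) :
    w ∈ ((L.deltaSplit.toLimitMixedHodgeStructure.sharp L.isSplitOverR_deltaSplit).F p).map (L.orbitPerturbation (Real.sqrt z.im)) := by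
  rw [L.nilpotentOrbit_F, L.map_exp_smul_N_F_eq_map_orbitAut p hz0] at hx
  obtain ⟨a, ha, hax⟩ := hx
  have haw : a = w := L.deltaSplit.toLimitMixedHodgeStructure.orbitAut_injective hz0 (hax.trans hw.symm)
  rw [← haw]
  exact ha

/-- **`w` is real when `x` is** (`ĝ_z ∈ G_ℝ`): `conj w = w`. [cite: CattaniDeligneKaplan1995, proof of Prop. 4.7 ("u₀ … real")] -/
theorem conj_eq_of_orbitAut_eq {z : ℂ} (hz0 : 0 < z.im) {w x : ℂ ⊗[ℚ] V} (hw : L.deltaSplit.toLimitMixedHodgeStructure.orbitAut z w = x)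
    (hreal : conj x = x) : conj w = w := by
  apply L.deltaSplit.toLimitMixedHodgeStructure.orbitAut_injective hz0
  have h : conj (L.deltaSplit.toLimitMixedHodgeStructure.orbitAut z w) =
      L.deltaSplit.toLimitMixedHodgeStructure.orbitAut z (conj w) := by
    rw [conj_apply_eq_endConj, L.deltaSplit.toLimitMixedHodgeStructure.endConj_orbitAut L.isSplitOverR_deltaSplit]
  rw [← h, hw, hreal]

/-- **`w ∈ W_{k,ℂ}` when `x ∈ W_{k,ℂ}`** (`exp(−(Re z)N)` and `ρ̃` preserve the weight filtration). [cite: CattaniDeligneKaplan1995, proof of Prop. 4.7] -/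
theorem mem_baseChange_W_of_orbitAut_eq {z : ℂ} (hz0 : 0 < z.im) {m : ℤ} {w x : ℂ ⊗[ℚ] V}
    (hw : L.deltaSplit.toLimitMixedHodgeStructure.orbitAut z w = x) (hx : x ∈ (L.W m).baseChange ℂ) :
    w ∈ (L.W m).baseChange ℂ := by
  rw [L.deltaSplit.toLimitMixedHodgeStructure.eq_splitTorus_inv_exp_neg_apply_orbitAut hz0 w, hw]
  refine L.deltaSplit.toLimitMixedHodgeStructure.splitTorus_apply_mem_baseChange_W _ ?_
  have e : -((z.re : ℂ) • L.N.baseChange ℂ) = (-(z.re : ℂ)) • L.N.baseChange ℂ := (neg_smul _ _).symm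
  show IsNilpotent.exp (-((z.re : ℂ) • L.N.baseChange ℂ)) x ∈ (L.W m).baseChange ℂ
  rw [e]
  exact L.toLimitMixedHodgeStructure.exp_smul_N_apply_mem_baseChange_W _ hx

/-- **`π̂_k w = π̂_k x` when `ĝ_z w = x ∈ W_{k,ℂ}`**: `ρ̃` is trivial on `Ê_k` and `π̂_k exp(−(Re z)N) x = π̂_k x` — «the
`0`-component `u(n)^{(0)}` coincides with» the top class. [cite: CattaniDeligneKaplan1995, proof of Prop. 4.7 (p. 504)] -/
theorem deligneEProj_self_eq_of_orbitAut_eq {z : ℂ} (hz0 : 0 < z.im) {w x : ℂ ⊗[ℚ] V}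
    (hw : L.deltaSplit.toLimitMixedHodgeStructure.orbitAut z w = x) (hx : x ∈ (L.W k).baseChange ℂ) :
    L.deltaSplit.toMixedHodgeStructure.deligneEProj k w = L.deltaSplit.toMixedHodgeStructure.deligneEProj k x := by
  have e : -((z.re : ℂ) • L.N.baseChange ℂ) = (-(z.re : ℂ)) • L.N.baseChange ℂ := (neg_smul _ _).symm
  conv_lhs => rw [L.deltaSplit.toLimitMixedHodgeStructure.eq_splitTorus_inv_exp_neg_apply_orbitAut hz0 w, hw]
  rw [L.deltaSplit.toLimitMixedHodgeStructure.deligneEProj_splitTorus_apply, sub_self, zpow_zero, one_smul]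
  show L.deltaSplit.toMixedHodgeStructure.deligneEProj k (IsNilpotent.exp (-((z.re : ℂ) • L.N.baseChange ℂ)) x) = _
  rw [e]
  exact L.deligneEProj_exp_smul_N_apply_of_mem_baseChange_W _ hx

/-! ## §3 The limit: CDK Prop. 4.7 at `d = 1` — the constant top class of a sequence of real Hodge classes of bounded norm at points
tending to the puncture is an `𝔰𝔩₂`-invariant limit Hodge class -/

/-- **CDK Prop. 4.7 for the one-variable nilpotent orbit.**  Let `x_n ∈ W_{k,ℂ}` be REAL (`x̄_n = x_n`) and of type `(p, k−p)` at the
points `θ(z_n)`, `Im z_n > β`, `Im z_n → ∞` (any `Re z_n`), with `‖x_n‖_{θ(z_n)} ≤ C` and with CONSTANT top component `π̂_k x_n = û`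
of the `δ`-grading.  Then **`N û = 0`, `N̂⁺ û = 0`, `Ĥ û = 0` and `û ∈ Î^{p,k−p}`** — «`u₀ ∈ F_♯⁰`, real … By 3.10, `u₀` … is in the
kernel of `T₁` … The `0`-component `u(n)^{(0)}` coincides with `u₀`, killed by `T₁`.»  Proof: the rescaled `w_n = ĝ_{z_n}⁻¹ x_n` are
`|·|₀`-bounded (§2); a subsequence converges in `(V_ℂ, |·|₀)` to `u₀ ∈ W_{k,ℂ} ∩ F̂_♯^p`, real, with `π̂_k u₀ = û`; Prop. 3.10 gives
`u₀ ∈ Ê_k ∩ ker N ∩ ker N̂⁺ ∩ Î^{p,p}`, so `u₀ = π̂_k u₀ = û`. [cite: CattaniDeligneKaplan1995, Prop. 4.7 and proof (pp. 503–504), Prop. 3.10 (p. 499)]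
[cite: CattaniKaplanSchmid1987, §3 Thm. (3.3), Cor. (3.7)] [cite: Schmid1973, Thm. (6.6) (cite only)] -/
theorem sl2_invariant_of_deligneEProj_eq_const (x : ℕ → ℂ ⊗[ℚ] V) (z : ℕ → ℂ) (hz : ∀ n, L.normThreshold < (z n).im)
    (hlim : Tendsto (fun n => (z n).im) atTop atTop) {C : ℝ}
    (hC : ∀ n, (L.nilpotentOrbitPolarization (z n) (L.orbitThreshold_lt_im (hz n))).hodgeNorm (x n) ≤ C)
    (hreal : ∀ n, conj (x n) = x n) (hW : ∀ n, x n ∈ (L.W k).baseChange ℂ) {p : ℤ}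
    (hx : ∀ n, x n ∈ (L.nilpotentOrbit (z n) (L.orbitThreshold_lt_im (hz n))).piece p (k - p)) {û : ℂ ⊗[ℚ] V}
    (hû : ∀ n, L.deltaSplit.toMixedHodgeStructure.deligneEProj k (x n) = û) :
    L.N.baseChange ℂ û = 0 ∧ L.deltaSplit.toLimitMixedHodgeStructure.nPlus û = 0 ∧
      L.deltaSplit.toLimitMixedHodgeStructure.deligneH û = 0 ∧ û ∈ L.deltaSplit.toMixedHodgeStructure.deligneI p (k - p) := by
  classical
  -- off the middle there are no real classes: `x_n = 0`, `û = 0`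
  by_cases hpk : p + p = k
  swap
  · have h0 : x 0 = 0 :=
      (L.nilpotentOrbit (z 0) (L.orbitThreshold_lt_im (hz 0))).eq_zero_of_conj_eq_of_mem_piece_of_ne (show p ≠ k - p by omega)
        (hreal 0) (hx 0)
    have hû0 : û = 0 := by rw [← hû 0, h0, map_zero]
    rw [hû0, map_zero, map_zero, map_zero]
    exact ⟨rfl, rfl, rfl, zero_mem _⟩
  have hkp : k - p = p := by omega
  -- notation
  have hs' := L.isSplitOverR_deltaSplit
  set P := L.deltaSplit.sharpPolarization L.isSplitOverR_deltaSplit with hP_def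
  have hz0 : ∀ n, 0 < (z n).im := fun n => L.im_pos_of_normThreshold_lt (hz n)
  -- §2: the rescaled vectors `w n = ĝ_{z n}⁻¹ (x n)`
  choose w hw using fun n => L.deltaSplit.toLimitMixedHodgeStructure.orbitAut_surjective (hz0 n) (x n)
  have hwn : ∀ n, L.referenceNorm (w n) ≤ 2 * C := fun n =>
    (L.referenceNorm_le_two_mul_hodgeNorm_of_orbitAut_eq (hz n) (hw n)).trans (by linarith [hC n])
  have hwW : ∀ n, w n ∈ (L.W k).baseChange ℂ := fun n => L.mem_baseChange_W_of_orbitAut_eq (hz0 n) (hw n) (hW n)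
  have hwr : ∀ n, conj (w n) = w n := fun n => L.conj_eq_of_orbitAut_eq (hz0 n) (hw n) (hreal n)
  have hwπ : ∀ n, L.deltaSplit.toMixedHodgeStructure.deligneEProj k (w n) = û := fun n => by
    rw [L.deligneEProj_self_eq_of_orbitAut_eq (hz0 n) (hw n) (hW n), hû n]
  have hwF : ∀ n, w n ∈ ((L.deltaSplit.toLimitMixedHodgeStructure.sharp hs').F p).map (L.orbitPerturbation (Real.sqrt (z n).im)) :=
    fun n => L.mem_map_orbitPerturbation_sharp_F_of_orbitAut_eq (L.orbitThreshold_lt_im (hz n)) (hz0 n) (hw n)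
      (((L.nilpotentOrbit (z n) _).mem_piece_iff (show p + (k - p) = k by omega)).1 (hx n)).1
  choose f hfF hfw using hwF
  obtain ⟨K, hK0, hK⟩ := L.exists_hodgeNorm_orbitPerturbation_sub_le
  -- the estimate `|f n - w n|₀ ≤ 4CK / Im (z n)` once `Im (z n) ≥ 2K`
  have hC0 : 0 ≤ C := (HodgeStructure.Polarization.hodgeNorm_nonneg _ _).trans (hC 0)
  -- the norm axioms of `|·|₀ = ‖·‖_{F̂_♯}` in `referenceNorm` form
  have hconj : ∀ v : ℂ ⊗[ℚ] V, L.referenceNorm (conj v) = L.referenceNorm v := fun v => P.hodgeNorm_conj v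
  have hsubrev : ∀ v v' : ℂ ⊗[ℚ] V, L.referenceNorm (v - v') = L.referenceNorm (v' - v) := fun v v' => P.hodgeNorm_sub_rev v v'
  have hadd : ∀ v v' : ℂ ⊗[ℚ] V, L.referenceNorm (v + v') ≤ L.referenceNorm v + L.referenceNorm v' :=
    fun v v' => P.hodgeNorm_add_le v v'
  have htri : ∀ v v' : ℂ ⊗[ℚ] V, L.referenceNorm v ≤ L.referenceNorm v' + L.referenceNorm (v - v') :=
    fun v v' => P.hodgeNorm_le_add_hodgeNorm_sub v v'
  have hfw_est : ∀ n, 2 * K ≤ (z n).im → L.referenceNorm (f n - w n) ≤ 4 * C * K / (z n).im := by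
    intro n hn
    have hy1 : 1 ≤ (z n).im := L.one_le_im_of_normThreshold_lt (hz n)
    have hy0 : 0 < (z n).im := hz0 n
    have ht1 : 1 ≤ Real.sqrt (z n).im := by rw [← Real.sqrt_one]; exact Real.sqrt_le_sqrt hy1
    have ht2 : Real.sqrt (z n).im ^ 2 = (z n).im := Real.sq_sqrt hy0.le
    have h1 : L.referenceNorm (w n - f n) ≤ K / (z n).im * L.referenceNorm (f n) := by
      have h := hK _ ht1 (f n)
      rwa [hfw n, ht2] at h
    have hKy : K / (z n).im ≤ 1 / 2 := by
      rw [div_le_iff₀ hy0]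
      linarith
    -- `|f|₀ ≤ |w|₀ + |w - f|₀ ≤ 2C + ½|f|₀`
    have h2 : L.referenceNorm (f n) ≤ 4 * C := by
      have h4 := htri (f n) (w n)
      rw [hsubrev (f n) (w n)] at h4
      have h3 : L.referenceNorm (w n - f n) ≤ 1 / 2 * L.referenceNorm (f n) :=
        h1.trans (mul_le_mul_of_nonneg_right hKy (L.referenceNorm_nonneg _))
      linarith [hwn n]
    rw [hsubrev (f n) (w n)]
    calc L.referenceNorm (w n - f n) ≤ K / (z n).im * L.referenceNorm (f n) := h1
      _ ≤ K / (z n).im * (4 * C) := mul_le_mul_of_nonneg_left h2 (div_nonneg hK0 hy0.le)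
      _ = 4 * C * K / (z n).im := by ring
  -- §3: topology of `(V_ℂ, |·|₀)` and a convergent subsequence of `w`
  letI := P.hodgeNormedAddCommGroup
  letI := P.hodgeInnerProductSpace
  have hnorm : ∀ v : ℂ ⊗[ℚ] V, ‖v‖ = L.referenceNorm v := fun v => rfl
  obtain ⟨a, -, φ, hφ, hlimw⟩ := tendsto_subseq_of_bounded (Metric.isBounded_closedBall (x := (0 : ℂ ⊗[ℚ] V)) (r := 2 * C))
    (x := w) fun n => by rw [Metric.mem_closedBall, dist_zero_right, hnorm]; exact hwn n
  have hdist : Tendsto (fun n => L.referenceNorm (w (φ n) - a)) atTop (𝓝 0) := by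
    have h := tendsto_iff_norm_sub_tendsto_zero.1 hlimw
    exact h
  -- (i) `a ∈ W_k`
  have haW : a ∈ (L.W k).baseChange ℂ :=
    (Submodule.closed_of_finiteDimensional ((L.W k).baseChange ℂ)).mem_of_tendsto hlimw (Eventually.of_forall fun n => hwW (φ n))
  -- (ii) `a` is real
  have hareal : conj a = a := by
    have hle : ∀ n, L.referenceNorm (conj a - a) ≤ 2 * L.referenceNorm (w (φ n) - a) := by
      intro n
      have e : conj a - a = conj (a - w (φ n)) + (w (φ n) - a) := by rw [map_sub, hwr]; abel
      calc L.referenceNorm (conj a - a) = L.referenceNorm (conj (a - w (φ n)) + (w (φ n) - a)) := by rw [e]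
        _ ≤ L.referenceNorm (conj (a - w (φ n))) + L.referenceNorm (w (φ n) - a) := hadd _ _
        _ = 2 * L.referenceNorm (w (φ n) - a) := by rw [hconj, hsubrev a]; ring
    have h0 : L.referenceNorm (conj a - a) ≤ 0 := by
      refine ge_of_tendsto (by simpa using hdist.const_mul 2) (Eventually.of_forall hle)
    exact sub_eq_zero.1 ((L.referenceNorm_eq_zero_iff _).1 (le_antisymm h0 (L.referenceNorm_nonneg _)))
  -- (iii) `a ∈ F̂_♯^p`
  have htφ : Tendsto (fun n => (z (φ n)).im) atTop atTop := hlim.comp hφ.tendsto_atTop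
  have hlimf : Tendsto (fun n => f (φ n)) atTop (𝓝 a) := by
    rw [tendsto_iff_norm_sub_tendsto_zero]
    have hb : Tendsto (fun n => 4 * C * K / (z (φ n)).im + L.referenceNorm (w (φ n) - a)) atTop (𝓝 0) := by
      have h1 : Tendsto (fun n => 4 * C * K / (z (φ n)).im) atTop (𝓝 0) := by
        have h := (tendsto_inv_atTop_zero.comp htφ).const_mul (4 * C * K)
        rw [mul_zero] at h
        exact h.congr fun n => by simp [div_eq_mul_inv]
      simpa using h1.add hdist
    refine squeeze_zero' (Eventually.of_forall fun n => norm_nonneg _) ?_ hb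
    refine (htφ.eventually (eventually_ge_atTop (2 * K))).mono fun n hn => ?_
    rw [hnorm]
    calc L.referenceNorm (f (φ n) - a) = L.referenceNorm ((f (φ n) - w (φ n)) + (w (φ n) - a)) := by rw [sub_add_sub_cancel]
      _ ≤ L.referenceNorm (f (φ n) - w (φ n)) + L.referenceNorm (w (φ n) - a) := hadd _ _
      _ ≤ 4 * C * K / (z (φ n)).im + L.referenceNorm (w (φ n) - a) := by linarith [hfw_est (φ n) hn]
  have haF : a ∈ (L.deltaSplit.toLimitMixedHodgeStructure.sharp hs').F p :=
    (Submodule.closed_of_finiteDimensional ((L.deltaSplit.toLimitMixedHodgeStructure.sharp hs').F p)).mem_of_tendsto hlimf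
      (Eventually.of_forall fun n => hfF (φ n))
  -- (iv) `π̂_k a = û`
  obtain ⟨Cπ, hCπ0, hCπ⟩ := P.exists_hodgeNorm_apply_le (L.deltaSplit.toMixedHodgeStructure.deligneEProj k)
  have haπ : L.deltaSplit.toMixedHodgeStructure.deligneEProj k a = û := by
    have hle : ∀ n, L.referenceNorm (L.deltaSplit.toMixedHodgeStructure.deligneEProj k a - û) ≤ Cπ * L.referenceNorm (w (φ n) - a) := by
      intro n
      have hneg : L.referenceNorm (w (φ n) - a) = L.referenceNorm (a - w (φ n)) := hsubrev _ _
      rw [← hwπ (φ n), ← map_sub, hneg]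
      exact hCπ _
    have h0 : L.referenceNorm (L.deltaSplit.toMixedHodgeStructure.deligneEProj k a - û) ≤ 0 := by
      refine ge_of_tendsto (by simpa using hdist.const_mul Cπ) (Eventually.of_forall hle)
    exact sub_eq_zero.1 ((L.referenceNorm_eq_zero_iff _).1 (le_antisymm h0 (L.referenceNorm_nonneg _)))
  -- (v) Prop. 3.10: `a` is `𝔰𝔩₂`-invariant and of pure weight `k`, hence `a = û`
  obtain ⟨hN, hNp, hH, hI⟩ := L.sl2_invariant_of_conj_eq_of_mem_baseChange_W_of_mem_deltaSplit_sharp_F hpk hareal haW haF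
  have haE : L.deltaSplit.toMixedHodgeStructure.deligneEProj k a = a :=
    L.deligneEProj_apply_eq_self_of_mem_baseChange_W_of_mem_sharp_piece haW
      ((L.deltaSplit.toLimitMixedHodgeStructure.sharp hs').mem_piece_of_conj_eq_of_mem_F hpk hareal haF)
  have hua : û = a := by rw [← haπ, haE]
  rw [hua, hkp]
  exact ⟨hN, hNp, hH, hI⟩

/-- **Corollary (the form consumed by the integral theorem): `N (π̂_k x_n) = 0`** — the constant top class of such a sequence is
killed by the monodromy logarithm («`u¹` is in the kernel of the morphism (4.6.1)»). [cite: CattaniDeligneKaplan1995, Prop. 4.7 (p. 503)] -/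
theorem N_deligneEProj_eq_zero_of_deligneEProj_eq_const (x : ℕ → ℂ ⊗[ℚ] V) (z : ℕ → ℂ) (hz : ∀ n, L.normThreshold < (z n).im)
    (hlim : Tendsto (fun n => (z n).im) atTop atTop) {C : ℝ}
    (hC : ∀ n, (L.nilpotentOrbitPolarization (z n) (L.orbitThreshold_lt_im (hz n))).hodgeNorm (x n) ≤ C)
    (hreal : ∀ n, conj (x n) = x n) (hW : ∀ n, x n ∈ (L.W k).baseChange ℂ) {p : ℤ}
    (hx : ∀ n, x n ∈ (L.nilpotentOrbit (z n) (L.orbitThreshold_lt_im (hz n))).piece p (k - p)) {û : ℂ ⊗[ℚ] V}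
    (hû : ∀ n, L.deltaSplit.toMixedHodgeStructure.deligneEProj k (x n) = û) (n : ℕ) :
    L.N.baseChange ℂ (L.deltaSplit.toMixedHodgeStructure.deligneEProj k (x n)) = 0 := by
  rw [hû n]
  exact (L.sl2_invariant_of_deligneEProj_eq_const x z hz hlim hC hreal hW hx hû).1

/-- **The fixed-class case (CDK Thm. 2.5 (ii), second clause, with VARYING `Re z`)**: a single REAL `v ∈ W_{k,ℂ}` which is of type
`(p, k−p)` at points `θ(z_n)` with `Im z_n → ∞` — no condition on `Re z_n` — has an `𝔰𝔩₂`-INVARIANT top class: `N (π̂_k v) = 0`,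
`N̂⁺ (π̂_k v) = 0`, `π̂_k v ∈ Î^{p,k−p}` (hence `π̂_k v ∈ Ĥ_♯^{p,k−p}`, the tree's vertical-ray statement
`deligneEProj_exp_neg_smul_N_apply_mem_sharp_piece` freed from `Re z = const`; the Hodge norm `‖v‖²_{θ(z_n)} = |Q(v,v)|` is automatically
bounded). [cite: CattaniDeligneKaplan1995, Thm. 2.5 (ii) (p. 488) and Thm. 2.16 (iii) (p. 492)] [cite: Schmid1973, Thm. (6.6) (cite only)] -/
theorem sl2_invariant_deligneEProj_of_mem_piece_seq {v : ℂ ⊗[ℚ] V} (hreal : conj v = v) (hW : v ∈ (L.W k).baseChange ℂ)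
    (z : ℕ → ℂ) (hz : ∀ n, L.normThreshold < (z n).im) (hlim : Tendsto (fun n => (z n).im) atTop atTop) {p : ℤ}
    (hv : ∀ n, v ∈ (L.nilpotentOrbit (z n) (L.orbitThreshold_lt_im (hz n))).piece p (k - p)) :
    L.N.baseChange ℂ (L.deltaSplit.toMixedHodgeStructure.deligneEProj k v) = 0 ∧
      L.deltaSplit.toLimitMixedHodgeStructure.nPlus (L.deltaSplit.toMixedHodgeStructure.deligneEProj k v) = 0 ∧
      L.deltaSplit.toLimitMixedHodgeStructure.deligneH (L.deltaSplit.toMixedHodgeStructure.deligneEProj k v) = 0 ∧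
      L.deltaSplit.toMixedHodgeStructure.deligneEProj k v ∈ L.deltaSplit.toMixedHodgeStructure.deligneI p (k - p) := by
  refine L.sl2_invariant_of_deligneEProj_eq_const (fun _ => v) z hz hlim (C := Real.sqrt ‖L.Q.baseChange ℂ v v‖) (fun n => ?_)
    (fun _ => hreal) (fun _ => hW) hv (fun _ => rfl)
  rw [← Real.sqrt_sq (HodgeStructure.Polarization.hodgeNorm_nonneg _ v),
    L.hodgeNorm_nilpotentOrbit_sq_of_mem_piece_of_conj_eq (L.orbitThreshold_lt_im (hz n)) (hv n) hreal]

end PolarizedLimitMixedHodgeStructure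

end HodgeTheory

end Literature.AlgebraicGeometry

end
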